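import Mathlib
import HarnessLib
import Summits.NavierStokesRegularity.FluidComputer.TriggeredTransferAmplifierValve

/-!
# Door N1-FC split into AMPLIFIER + VALVE: both pieces dilate — the split is viscosity-free too

Cell `ns-blowup`, seat `ns-blowup-fc-prover-1` g4 (D-0074 GROUP C «bridge support»; LADDER-NS rung N1-FC).
Companion of `TriggeredTransferAmplifierValve.lean` (the planner's typing `KickAlphabet` / `Amplifies` /
`Valve` of shape (α′), its glue `stepGluing`) and of `TriggeredTransferViscosity(Robust).lean` (seat
`ns-blowup-fc-prover-2`: Tao's time dilation `u ↦ κ·u(κt, x)` — Anal. PDE 2013, footnote 3 — carried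
through every OTHER typing of the door: `Step`/`Transfers`, `StepWithin`/…, `StepB`/`TransfersB`).
LABEL: E–C typing / calibration. WHAT THIS IS NOT: not Navier–Stokes evidence — a change of variables
applied to OPEN predicates; no scheme, no kicked alphabet, no transfer and no blow-up is asserted.

* `KickAlphabet.dilate κ`: kicked states `V ↦ κ • K (V/κ)` over the dilated scheme `𝒮.dilate κ`
  (Clay clauses and the speed floor scale like the alphabet's, `TriggerScheme.dilate`);
* `Amplifies.dilate`: an amplifier at viscosity `ν` is an amplifier of the dilated design at
  viscosity `κν` — the logarithmic law `(C_τ/2)(1 + |log ε|)^q / U` and the admissibility clause are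
  exactly covariant, the kicked target `u T₁ ∈ K U` becomes `κ • u T₁ ∈ κ • K U`, ceilings `× κ`;
* `Valve.dilate`: a valve at viscosity `ν` is a valve of the dilated design at `κν` — the Re-uniform law
  `(C_τ/2) / U` is covariant, the unforced system stays unforced, the exact hand-over dilates
  (`handover_dilate`);
* `exists_pieces_iff_of_pos` / `exists_pieces_iff_one`: for all `ν, ν' > 0`,
  `(∃ 𝒮 𝒦, Amplifies 𝒮 𝒦 ν ∧ Valve 𝒮 𝒦 ν) ↔ (∃ 𝒮 𝒦, Amplifies 𝒮 𝒦 ν' ∧ Valve 𝒮 𝒦 ν')` — the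
  package's unit-viscosity words `PiecesAtOne` read the same proposition at any DNS viscosity, like every
  other typing of the door; and the Re-dictionaries `Amplifies.of_div` / `Valve.of_div` (a piece at the
  LOWER viscosity `ν/κ` is the piece of the dilated design at viscosity `ν`, amplitudes `× κ`).

References: T. Tao, Anal. PDE 6 (2013), footnote 3 [cite: Tao2011, footnote 3]; T. Tao, J. Amer. Math.
Soc. 29 (2016) §1.3 [cite: Tao2016AveragedNS, §1.3]. 0 sorry; axioms ⊆ {propext, Classical.choice,
Quot.sound}.
-/

noncomputable section

namespace Summit.NavierStokesRegularity.FluidComputer.TriggeredTransfer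

open Set MeasureTheory Function
open scoped ENNReal ContDiff NNReal
open Literature.Analysis.FluidPDE
open Literature.Analysis.FluidPDE.FluidComputer (E3 Vel)
open Summit.NavierStokesRegularity.NavierStokesRegularity.Theorems (isClassicalNSSolutionOn_viscosityChange)
open Summit.NavierStokesRegularity.FluidComputer.PalasekTowerClayBridge (hasRapidSpatialDecay_const_smul)

namespace TriggerScheme

variable {𝒮 : TriggerScheme} {κ : ℝ}

/-! ## The dilated kicked alphabet -/

/-- **The kicked alphabet read at amplitude `× κ`** (`κ > 0`): kicked states `V ↦ κ • K (V/κ)`, a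
kicked alphabet of the dilated scheme `𝒮.dilate κ` (the Clay clauses are preserved by constant
multiples; the speed floor `c · V ≤ ‖κ • v x‖` follows from `c · (V/κ) ≤ ‖v x‖`).
[cite: Tao2011, footnote 3] -/
def KickAlphabet.dilate (𝒦 : 𝒮.KickAlphabet) (κ : ℝ) (hκ : 0 < κ) : (𝒮.dilate κ hκ).KickAlphabet where
  K := fun V => (fun v : Vel => κ • v) '' 𝒦.K (V / κ)
  clay := by
    rintro V hV v ⟨w, hw, rfl⟩
    rw [dilate_UStar] at hV
    have hVκ : 𝒮.UStar ≤ V / κ := by rwa [le_div_iff₀ hκ, mul_comm]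
    obtain ⟨h1, h2, h3⟩ := 𝒦.clay (V / κ) hVκ w hw
    exact ⟨h1.const_smul κ, VectorCalculus.IsDivFree.const_smul (h1.differentiable (by simp)) h2 κ,
      hasRapidSpatialDecay_const_smul h3 h1 κ⟩
  floor := by
    rintro V hV v ⟨w, hw, rfl⟩
    rw [dilate_UStar] at hV
    have hVκ : 𝒮.UStar ≤ V / κ := by rwa [le_div_iff₀ hκ, mul_comm]
    obtain ⟨x, hxR, hfl⟩ := 𝒦.floor (V / κ) hVκ w hw
    refine ⟨x, hxR, ?_⟩
    show 𝒮.c * V ≤ ‖κ • w x‖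
    rw [norm_smul, Real.norm_of_nonneg hκ.le]
    calc 𝒮.c * V = κ * (𝒮.c * (V / κ)) := by field_simp
      _ ≤ κ * ‖w x‖ := mul_le_mul_of_nonneg_left hfl hκ.le

/-- The dilated kicked states at amplitude `V` are `κ •` the kicked states at amplitude `V/κ`. [folklore] -/
@[simp] theorem KickAlphabet.dilate_K (𝒦 : 𝒮.KickAlphabet) (hκ : 0 < κ) (V : ℝ) :
    (𝒦.dilate κ hκ).K V = (fun v : Vel => κ • v) '' 𝒦.K (V / κ) := rfl

/-- Kicked states, multiplied by `κ`, are kicked states of the dilated alphabet one dilation up: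
`v ∈ K U ⇒ κ • v ∈ (𝒦.dilate κ).K (κ U)`. [folklore] -/
theorem KickAlphabet.smul_mem_dilate_K (𝒦 : 𝒮.KickAlphabet) (hκ : 0 < κ) {U : ℝ} {v : Vel}
    (hv : v ∈ 𝒦.K U) : κ • v ∈ (𝒦.dilate κ hκ).K (κ * U) := by
  rw [KickAlphabet.dilate_K, mul_div_cancel_left₀ U hκ.ne']
  exact mem_image_of_mem _ hv

/-! ## Elementary covariance of the two clock laws -/

/-- The logarithmic (amplifier) law is covariant: `T ≤ (C_τ/2)(1+|log ε|)^q/(V/κ)` gives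
`T/κ ≤ (C_τ/2)(1+|log ε|)^q/V`. [folklore] -/
theorem amplifierClock_dilate (hκ : 0 < κ) {T ε V : ℝ}
    (hT : T ≤ 𝒮.Cτ / 2 * (1 + |Real.log ε|) ^ 𝒮.q / (V / κ)) :
    T / κ ≤ 𝒮.Cτ / 2 * (1 + |Real.log ε|) ^ 𝒮.q / V := by
  calc T / κ ≤ 𝒮.Cτ / 2 * (1 + |Real.log ε|) ^ 𝒮.q / (V / κ) / κ := div_le_div_of_nonneg_right hT hκ.le
    _ = 𝒮.Cτ / 2 * (1 + |Real.log ε|) ^ 𝒮.q / V := by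
        rw [div_div, div_mul_cancel₀ V hκ.ne']

/-- The Re-uniform (valve) law is covariant: `T ≤ (C_τ/2)/(V/κ)` gives `T/κ ≤ (C_τ/2)/V`. [folklore] -/
theorem valveClock_dilate (hκ : 0 < κ) {T V : ℝ} (hT : T ≤ 𝒮.Cτ / 2 / (V / κ)) :
    T / κ ≤ 𝒮.Cτ / 2 / V := by
  calc T / κ ≤ 𝒮.Cτ / 2 / (V / κ) / κ := div_le_div_of_nonneg_right hT hκ.le
    _ = 𝒮.Cτ / 2 / V := by rw [div_div, div_mul_cancel₀ V hκ.ne']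

/-- The dilated time slab is mapped into the original one by `s ↦ κ s`. [folklore] -/
theorem mapsTo_mul_Icc (hκ : 0 < κ) (S : ℝ) :
    MapsTo (fun s => κ * s) (Icc (0 : ℝ) (S / κ)) (Icc 0 S) := fun s hs =>
  ⟨mul_nonneg hκ.le hs.1, by
    have := mul_le_mul_of_nonneg_left hs.2 hκ.le
    rwa [mul_div_cancel₀ _ hκ.ne'] at this⟩

/-! ## The amplifier dilates -/

/-- **Amplifiers dilate** (Tao's footnote 3 through piece T): an amplifier of `(𝒮, 𝒦)` at viscosity
`ν` is an amplifier of `(𝒮.dilate κ, 𝒦.dilate κ)` at viscosity `κν` — a member of the dilated alphabet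
at amplitude `V` is `κ • w`, `w ∈ F (V/κ)`; the seed `ε` admissible at `(κν, V)` is admissible at
`(ν, V/κ)` (`admissible_div`); the amplifier run from `w` dilates (`piece_dilate`: margin `δ/κ`, time
`T₁/κ` within the covariant logarithmic law, trigger `κ²g(κt,x)`, solution `κu(κt,x)` at viscosity
`κν`, energy `× κ²`), its ceiling becomes `κM` (`ceiling_dilate`), and its kicked target `u T₁ ∈ K (V/κ)`
becomes `κ • u T₁ ∈ (𝒦.dilate κ).K V`. [cite: Tao2011, footnote 3] -/
theorem Amplifies.dilate {𝒦 : 𝒮.KickAlphabet} (hκ : 0 < κ) {ν : ℝ} (h : 𝒮.Amplifies 𝒦 ν) :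
    (𝒮.dilate κ hκ).Amplifies (𝒦.dilate κ hκ) (κ * ν) := by
  rintro V hV v ⟨w, hw, rfl⟩ ε hε hε1 hadm
  rw [dilate_UStar] at hV
  rw [dilate_a] at hadm
  have hVκ : 𝒮.UStar ≤ V / κ := by rwa [le_div_iff₀ hκ, mul_comm]
  have hVκ_pos : 0 < V / κ := 𝒮.UStar_pos.trans_le hVκ
  obtain ⟨T₁, δ, g, u, p, hδ, h2δ, hT₁, hg, hsol, hu0, hE, ⟨M, hM⟩, hk⟩ :=
    h (V / κ) hVκ w hw ε hε hε1 (admissible_div hκ hadm)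
  -- the full law is weaker than the half law: feed `piece_dilate`
  have hT₁' : T₁ ≤ 𝒮.Cτ * (1 + |Real.log ε|) ^ 𝒮.q / (V / κ) := by
    refine hT₁.trans (div_le_div_of_nonneg_right ?_ hVκ_pos.le)
    have h1 : 0 ≤ (1 + |Real.log ε|) ^ 𝒮.q := le_trans zero_le_one (𝒮.one_le_logFactor ε)
    nlinarith [𝒮.Cτ_pos, h1]
  obtain ⟨h1, h2, -, h4, h5, h6, h7⟩ := piece_dilate hκ hδ h2δ hT₁' hg hsol hu0 hE
  refine ⟨T₁ / κ, δ / κ, timeRescale κ (κ ^ 2) g, timeRescale κ κ u, timeRescale κ (κ ^ 2) p, h1, h2,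
    ?_, h4, h5, h6, h7, ⟨κ * M, ceiling_dilate hκ hM⟩, ?_⟩
  · rw [dilate_Cτ, dilate_q]
    exact amplifierClock_dilate hκ hT₁
  · -- the kicked target dilates
    have hKV : κ • u T₁ ∈ (𝒦.dilate κ hκ).K V := by
      have := 𝒦.smul_mem_dilate_K hκ hk
      rwa [mul_div_cancel₀ _ hκ.ne'] at this
    rw [timeRescale_slice, mul_div_cancel₀ _ hκ.ne']
    exact hKV

/-- **Re-dictionary for the amplifier**: an amplifier at the LOWER viscosity `ν/κ` is an amplifier of
the dilated design at viscosity `ν` (amplitudes `× κ`). [cite: Tao2011, footnote 3] -/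
theorem Amplifies.of_div {𝒦 : 𝒮.KickAlphabet} (hκ : 0 < κ) {ν : ℝ} (h : 𝒮.Amplifies 𝒦 (ν / κ)) :
    (𝒮.dilate κ hκ).Amplifies (𝒦.dilate κ hκ) ν := by
  have := h.dilate hκ
  rwa [mul_div_cancel₀ _ hκ.ne'] at this

/-! ## The valve dilates -/

/-- The dilated zero force is the zero force. [folklore] -/
theorem timeRescale_zero_vel (a c : ℝ) :
    timeRescale a c (fun _ : ℝ => (0 : Vel)) = fun _ => (0 : Vel) := by
  funext s x
  rw [timeRescale_apply, Pi.zero_apply, smul_zero]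

/-- **Valves dilate** (Tao's footnote 3 through piece V): a valve of `(𝒮, 𝒦)` at viscosity `ν` is a
valve of `(𝒮.dilate κ, 𝒦.dilate κ)` at viscosity `κν` — from `κ • v`, `v ∈ K (V/κ)`, the valve run
`u` from `v` dilates to the unforced classical solution `κu(κt,x)` at viscosity `κν` on
`[0, T₂/κ + δ/κ]` (`isClassicalNSSolutionOn_viscosityChange`), time `T₂/κ` within the covariant
Re-uniform law, energy `× κ²`, ceiling `κM`, hand-over `λ-zoom of (κ • w')` with
`κ • w' ∈ (𝒮.dilate κ).F (κU')` and `growth · V ≤ κU'`. [cite: Tao2011, footnote 3] -/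
theorem Valve.dilate {𝒦 : 𝒮.KickAlphabet} (hκ : 0 < κ) {ν : ℝ} (h : 𝒮.Valve 𝒦 ν) :
    (𝒮.dilate κ hκ).Valve (𝒦.dilate κ hκ) (κ * ν) := by
  rintro V hV v' ⟨v, hv, rfl⟩
  rw [dilate_UStar] at hV
  have hVκ : 𝒮.UStar ≤ V / κ := by rwa [le_div_iff₀ hκ, mul_comm]
  obtain ⟨T₂, δ, u, p, hδ, h2δ, hT₂, hsol, hu0, ⟨C, hC, hE⟩, ⟨M, hM⟩, U', w', x₀, hgrow, hw', hx₀,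
    hhand⟩ := h (V / κ) hVκ v hv
  have hTδ : 0 < T₂ + δ := by linarith
  have hsum : T₂ / κ + δ / κ = (T₂ + δ) / κ := (add_div T₂ δ κ).symm
  refine ⟨T₂ / κ, δ / κ, timeRescale κ κ u, timeRescale κ (κ ^ 2) p, div_pos hδ hκ, ?_, ?_, ?_, ?_,
    ?_, ⟨κ * M, ceiling_dilate hκ hM⟩, κ * U', κ • w', x₀, ?_, 𝒮.smul_mem_dilate_F κ hκ hw', hx₀,
    handover_dilate hκ hhand⟩
  · -- `2 (δ/κ) < T₂/κ`
    rw [← mul_div_assoc]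
    exact div_lt_div_of_pos_right h2δ hκ
  · -- the Re-uniform law is covariant
    rw [dilate_Cτ]
    exact valveClock_dilate hκ hT₂
  · -- the dilated unforced solution (viscosity `κ ν`)
    have h5 := isClassicalNSSolutionOn_viscosityChange hsol κ (mapsTo_mul_Icc hκ (T₂ + δ))
      (uniqueDiffOn_Icc (div_pos hTδ hκ))
    rw [timeRescale_zero_vel] at h5
    rw [hsum]
    exact h5
  · -- initial slice
    rw [timeRescale_zero, hu0]
    rfl
  · -- finite energy on the slab (`× κ²`)
    refine ⟨ENNReal.ofReal (κ ^ 2) * C, ENNReal.mul_lt_top ENNReal.ofReal_lt_top hC, fun t ht => ?_⟩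
    rw [hsum] at ht
    rw [timeRescale_slice, lintegral_enorm_sq_const_smul]
    exact mul_le_mul_right (hE (κ * t) (mapsTo_mul_Icc hκ (T₂ + δ) ht)) _
  · -- amplitude bookkeeping: `growth · V ≤ κ U'`
    rw [dilate_growth]
    calc 𝒮.growth * V = κ * (𝒮.growth * (V / κ)) := by field_simp
      _ ≤ κ * U' := mul_le_mul_of_nonneg_left hgrow hκ.le

/-- **Re-dictionary for the valve**: a valve at the LOWER viscosity `ν/κ` is a valve of the dilated
design at viscosity `ν`. [cite: Tao2011, footnote 3] -/
theorem Valve.of_div {𝒦 : 𝒮.KickAlphabet} (hκ : 0 < κ) {ν : ℝ} (h : 𝒮.Valve 𝒦 (ν / κ)) :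
    (𝒮.dilate κ hκ).Valve (𝒦.dilate κ hκ) ν := by
  have := h.dilate hκ
  rwa [mul_div_cancel₀ _ hκ.ne'] at this

/-! ## The split is viscosity-free -/

/-- **One viscosity gives all, for the pieces**: a design with an amplifier and a valve at viscosity
`ν > 0` gives one at any other viscosity `ν' > 0` (dilate scheme AND kicked alphabet by `κ = ν'/ν`).
[cite: Tao2011, footnote 3] -/
theorem exists_pieces_of_pos {ν ν' : ℝ} (hν : 0 < ν) (hν' : 0 < ν')
    (h : ∃ (𝒮 : TriggerScheme) (𝒦 : 𝒮.KickAlphabet), 𝒮.Amplifies 𝒦 ν ∧ 𝒮.Valve 𝒦 ν) :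
    ∃ (𝒮 : TriggerScheme) (𝒦 : 𝒮.KickAlphabet), 𝒮.Amplifies 𝒦 ν' ∧ 𝒮.Valve 𝒦 ν' := by
  obtain ⟨𝒮, 𝒦, hA, hV⟩ := h
  have hκ : 0 < ν' / ν := div_pos hν' hν
  have hκν : ν' / ν * ν = ν' := div_mul_cancel₀ ν' hν.ne'
  refine ⟨𝒮.dilate (ν' / ν) hκ, 𝒦.dilate (ν' / ν) hκ, ?_, ?_⟩
  · have := hA.dilate hκ
    rwa [hκν] at this
  · have := hV.dilate hκ
    rwa [hκν] at this

/-- **Viscosity is not a parameter of the split door**: for all `ν, ν' > 0`,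
`(∃ 𝒮 𝒦, Amplifies 𝒮 𝒦 ν ∧ Valve 𝒮 𝒦 ν) ↔ (∃ 𝒮 𝒦, Amplifies 𝒮 𝒦 ν' ∧ Valve 𝒮 𝒦 ν')`.
[cite: Tao2011, footnote 3] -/
theorem exists_pieces_iff_of_pos {ν ν' : ℝ} (hν : 0 < ν) (hν' : 0 < ν') :
    (∃ (𝒮 : TriggerScheme) (𝒦 : 𝒮.KickAlphabet), 𝒮.Amplifies 𝒦 ν ∧ 𝒮.Valve 𝒦 ν) ↔
      ∃ (𝒮 : TriggerScheme) (𝒦 : 𝒮.KickAlphabet), 𝒮.Amplifies 𝒦 ν' ∧ 𝒮.Valve 𝒦 ν' :=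
  ⟨exists_pieces_of_pos hν hν', exists_pieces_of_pos hν' hν⟩

/-- **The package's words are the hypothesis at the DNS viscosity**: for every `ν₀ > 0`,
`(∃ 𝒮 𝒦, Amplifies 𝒮 𝒦 ν₀ ∧ Valve 𝒮 𝒦 ν₀) ↔ (∃ 𝒮 𝒦, Amplifies 𝒮 𝒦 1 ∧ Valve 𝒮 𝒦 1)`
(`PiecesAtOne` of `Sketch_alpha.lean`). [cite: Tao2011, footnote 3] -/
theorem exists_pieces_iff_one {ν : ℝ} (hν : 0 < ν) :
    (∃ (𝒮 : TriggerScheme) (𝒦 : 𝒮.KickAlphabet), 𝒮.Amplifies 𝒦 ν ∧ 𝒮.Valve 𝒦 ν) ↔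
      ∃ (𝒮 : TriggerScheme) (𝒦 : 𝒮.KickAlphabet), 𝒮.Amplifies 𝒦 1 ∧ 𝒮.Valve 𝒦 1 :=
  exists_pieces_iff_of_pos hν one_pos

end TriggerScheme

end Summit.NavierStokesRegularity.FluidComputer.TriggeredTransfer

end
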